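import Literature.NumberTheory.GaloisRepresentations.HeckeCharacterOfGrossencharakter
import Literature.NumberTheory.GaloisRepresentations.HeckeCharacterWeakApproximation
import HarnessLib

/-!
# Two Größencharakter data that agree at almost all primes have the same Hecke character («multiplicity one for `GL(1)`»)

Topic `Literature/NumberTheory/GaloisRepresentations`, namespace `Literature.NumberTheory.GaloisRepresentations`.  THEOREMS ONLY
(no definition, no instance, no named fact, no `sorry`).  Companion of `HeckeCharacterOfGrossencharakter` (Neukirch VII (6.14): the Hecke
character `heckeOfGross h𝔣 hψ` of an ideal Größencharakter `ψ mod 𝔣` of type `(p, q)`) and `HeckeCharacterWeakApproximation`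
(`HeckeCharacter.ext_of_eventually_valueAtUniformizer_eq`: a Hecke character is determined by almost all of its values at uniformizers,
Cassels–Fröhlich VII (Tate) Prop. 4.1).  The ideal-theoretic corollary, used whenever the SAME character is presented with two
different moduli (e.g. Ireland–Rosen Ch. 18 §7: the character of `y² = x³ + D` «for the modulus `12D`», whose conductor may be smaller —
in the tree `EisensteinSextic.psi (16u)` mod `(576u)` versus `EisensteinSextic.psiOdd u` mod `(9u)`):

* ★ `heckeOfGross_eq_of_eventually_eq` — `ψ v = ψ' v` for all but finitely many `v` ⟹ `heckeOfGross h𝔣 hψ = heckeOfGross h𝔣' hψ'`;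
* `heckeOfGross_eq_of_forall_not_mem` — the same with the exceptional set given as the primes of a non-zero element `m`.

Consequences (ramification, values at uniformizers, `L`-functions transfer between the two presentations) are then `rw`s.  Filed for the
row `j = 0` of `Deuring_exists_heckeCharacter_of_maximalCM` (route `BiquadraticEisensteinDescent` of `Summits/BirchSwinnertonDyer`, crux 21341,
cell `bsd-wall`, seat w4 g18); nothing about BSD is proved here.

## References
* J. W. S. Cassels, A. Fröhlich (eds.), *Algebraic Number Theory* (1967), Ch. VII (Tate) §4 Prop. 4.1. [CasselsFrohlichANT1967]
* J. Neukirch, *Algebraic Number Theory* (1999), Ch. VII §6 Cor. (6.14). [NeukirchANT1999]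
* K. Ireland, M. Rosen, *A Classical Introduction to Modern Number Theory*, 2nd ed. (1990), Ch. 18 §7. [IrelandRosen1990]

## Mathlib / tree search
Tree: `heckeOfGross`, `heckeOfGross_valueAtUniformizer` (`HeckeCharacterOfGrossencharakter`); `HeckeCharacter.ext_of_eventually_valueAtUniformizer_eq`,
`HeckeCharacter.eq_one_of_eventually_valueAtUniformizer_eq_one` (`HeckeCharacterWeakApproximation`); the Galois-side twin
`HeckeCharacter.eq_of_valueAtUniformizer_eq_det` (`ArtinLFunctionsAbelianFrobeniusProofs`) and the CM-side use
`ReflexNormIdeleCharacter.heckeCharacter_eq_of_valueAtUniformizer_eq`; no ideal-datum-vs-ideal-datum form existed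
(`lean search 'heckeOfGross_eq'`).  Mathlib: `Ideal.finite_factors`, `Filter.eventually_cofinite`, `Filter.Eventually.mono`.
-/

noncomputable section

open NumberField IsDedekindDomain IsDedekindDomain.HeightOneSpectrum Filter
open scoped NumberTheorySymbols ComplexConjugate

namespace Literature.NumberTheory.GaloisRepresentations

/-! ### §1 Two Größencharakter data that agree almost everywhere have the same Hecke character -/

section Rigidity

variable {K : Type*} [Field K] [NumberField K]
  {𝔣 𝔣' : Ideal (𝓞 K)} {p q : InfinitePlace K → ℤ} {ψ ψ' : HeightOneSpectrum (𝓞 K) → ℂ}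

/-- ★ **Multiplicity one for `GL(1)`, ideal-theoretic form.**  If two Größencharakter data `ψ mod 𝔣`, `ψ' mod 𝔣'` of the same infinity
type agree at all but finitely many primes, their Hecke characters `heckeOfGross` (Neukirch VII (6.14)) are EQUAL: both are unramified
off `𝔣𝔣'` with `ω(ϖ_𝔭) = ψ(𝔭)`, `ω'(ϖ_𝔭) = ψ'(𝔭)` there (`heckeOfGross_valueAtUniformizer`), so they agree at almost every uniformizer,
and a Hecke character is determined by almost all of its values at uniformizers (Cassels–Fröhlich VII Prop. 4.1; tree
`HeckeCharacter.ext_of_eventually_valueAtUniformizer_eq`). [cite: CasselsFrohlichANT1967, Ch. VII §4 Prop. 4.1 (proof)] [cite: NeukirchANT1999, Ch. VII §6 Cor. (6.14)] -/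
theorem heckeOfGross_eq_of_eventually_eq (h𝔣 : 𝔣 ≠ ⊥) (h𝔣' : 𝔣' ≠ ⊥) (hψ : IsGrossencharakter 𝔣 p q ψ)
    (hψ' : IsGrossencharakter 𝔣' p q ψ') (h : ∀ᶠ v in cofinite, ψ v = ψ' v) :
    heckeOfGross h𝔣 hψ = heckeOfGross h𝔣' hψ' := by
  refine HeckeCharacter.ext_of_eventually_valueAtUniformizer_eq ?_
  -- off the (finitely many) primes of `𝔣` and of `𝔣'` the values at uniformizers are `ψ v`, `ψ' v`
  have h1 : ∀ᶠ v : HeightOneSpectrum (𝓞 K) in cofinite, ¬ 𝔣 ≤ v.asIdeal :=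
    eventually_cofinite.mpr ((Ideal.finite_factors h𝔣).subset fun v hv => by
      by_contra hle; exact hv fun hle' => hle (Ideal.dvd_iff_le.mpr hle'))
  have h2 : ∀ᶠ v : HeightOneSpectrum (𝓞 K) in cofinite, ¬ 𝔣' ≤ v.asIdeal :=
    eventually_cofinite.mpr ((Ideal.finite_factors h𝔣').subset fun v hv => by
      by_contra hle; exact hv fun hle' => hle (Ideal.dvd_iff_le.mpr hle'))
  filter_upwards [h, h1, h2] with v hv hv1 hv2
  rw [heckeOfGross_valueAtUniformizer h𝔣 hψ hv1, heckeOfGross_valueAtUniformizer h𝔣' hψ' hv2, hv]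

/-- **Same, with the exceptional set given as the primes of a non-zero element `m`**: if `ψ v = ψ' v` whenever `m ∉ 𝔭_v`, then
`heckeOfGross h𝔣 hψ = heckeOfGross h𝔣' hψ'`. [cite: CasselsFrohlichANT1967, Ch. VII §4 Prop. 4.1 (proof)] [cite: NeukirchANT1999, Ch. VII §6 Cor. (6.14)] -/
theorem heckeOfGross_eq_of_forall_not_mem (h𝔣 : 𝔣 ≠ ⊥) (h𝔣' : 𝔣' ≠ ⊥) (hψ : IsGrossencharakter 𝔣 p q ψ)
    (hψ' : IsGrossencharakter 𝔣' p q ψ') {m : 𝓞 K} (hm : m ≠ 0)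
    (h : ∀ v : HeightOneSpectrum (𝓞 K), m ∉ v.asIdeal → ψ v = ψ' v) :
    heckeOfGross h𝔣 hψ = heckeOfGross h𝔣' hψ' := by
  refine heckeOfGross_eq_of_eventually_eq h𝔣 h𝔣' hψ hψ' ?_
  have hsp : Ideal.span {m} ≠ ⊥ := by rwa [Ne, Ideal.span_singleton_eq_bot]
  refine (eventually_cofinite.mpr ((Ideal.finite_factors hsp).subset fun v hv => ?_)).mono fun v hv => h v hv
  by_contra hle
  exact hv fun hm' => hle (Ideal.dvd_iff_le.mpr ((Ideal.span_singleton_le_iff_mem _).mpr hm'))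

end Rigidity

end Literature.NumberTheory.GaloisRepresentations

end
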